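import Literature.AlgebraicGeometry.HodgeTheory.QuaternionicQuarticFermatMemberCharts
import HarnessLib

/-!
# The double plane of the quaternionic quartic at ANY parameter: chart factorisations of the branch form

Layer `Literature/AlgebraicGeometry/HodgeTheory`, namespace `Literature.AlgebraicGeometry.HodgeTheory.Q8Family`. Theorems only (no
definition, no named fact). Written by the prover seat `leafhand-hodge-q8symplecticpowers-4` (g5, cell `pub-hsemireg`) as the
parameter-uniform half of the openness step (T3) of the S1 programme of route `HodgeConjecture/Q8SymplecticPowers` (crux K1Q,
stmt-HodgeConjecture-24190; consumer: hypothesis `hOpen` of `Q8SymplecticPowersRegularOfNodalBasicOpen.stub_regularVeryGeneralQ_of_nodalBasicOpen`).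

For EVERY parameter `a` and every `d` (the files `…Coordinates ∕ …Integral`): the branch form is
`G₂ = planeG₂ a d = κ · (s³ − s) · y · Ψ₂`, `κ = d·(a₀ + a₁)` (`planeA₂_eq`), with `Ψ₂ = planeΨ₂ a d = ψ_a(u₀(s,y), u₁(s,y), 1)`, and
`Ψ₂` obeys the support bounds `deg_y ≤ e − 1`, pole order `≤ 0` (its monomials are `s^{2i} y^{j}`, `i ≤ j ≤ e − 1`). Hence, by the
chart calculus (`HirzebruchTwoChartCalculus ∕ …Bounds`), for `e ≥ 1`:
* `chartThree e G₂ = κ · (s³ − s) · chartThree (e−1) Ψ₂`, * `s′ · chartTwo 1 G₂ = −κ · (s′³ − s′)·y′ · chartTwo 0 Ψ₂`,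
* `s′ · chartFour e 1 G₂ = −κ · (s′³ − s′) · chartFour (e−1) 0 Ψ₂`, and the support bounds of `IsChartExact e 1 G₂` hold.
So the nodality package of `hOpen` at `a` reduces (via `QuaternionicQuarticDoublePlaneNodalConfig`) to conditions on `Ψ₂(a)` and its
three transforms alone. Honest scope: explicit algebra; nothing here bears on HC; S1 ∕ K1Q NOT proved here.

References: [Hartshorne1977] V.2 (ruled surfaces); [Naie2007] §1.2; [Zariski1929].
-/

noncomputable section

open MvPolynomial
open Literature.AlgebraicGeometry.Motives Literature.AlgebraicGeometry.Motives.UniversalHypersurface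
open Literature.AlgebraicGeometry.Surfaces.HirzebruchTwoDoublePlane

namespace Literature.AlgebraicGeometry.HodgeTheory.Q8Family

variable {e : ℕ} (a : CIdx e → ℂ) (d : ℂ)

/-! ### The factorisation `G₂ = κ·(s³ − s)·y·Ψ₂` -/

/-- **`G₂ = κ · (s³ − s) · y · Ψ₂`**, `κ = d·(a₀ + a₁)`, at every parameter. [cite: Naie2007, §1.2 (normalization procedure) and Example 1] -/
theorem planeG₂_eq_C_mul_cubicY_mul :
    planeG₂ a d = C (d * (coefLin a 0 + coefLin a 1)) * (X 0 * (X 0 - 1) * (X 0 + 1) * X 1) * planeΨ₂ a d := by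
  rw [planeG₂, planeA₂_eq, map_mul]
  ring

/-! ### Support bounds of `Ψ₂` at every parameter -/

/-- `deg_y` bound of a finite product (sum of the bounds). [cite: Hartshorne1977, V.2 (ruled surfaces)] -/
theorem yBound_finsetProd {ι : Type*} (s : Finset ι) (F : ι → MvPolynomial (Fin 2) ℂ) (α : ι → ℕ)
    (h : ∀ i ∈ s, ∀ m ∈ (F i).support, m 1 ≤ α i) : ∀ m ∈ (∏ i ∈ s, F i).support, m 1 ≤ ∑ i ∈ s, α i := by
  classical
  induction s using Finset.induction_on with
  | empty =>
    intro m hm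
    rw [Finset.prod_empty, ← C_1, C_apply] at hm
    have h1 : m ∈ ({0} : Finset (Fin 2 →₀ ℕ)) := support_monomial_subset hm
    rw [Finset.mem_singleton] at h1
    simp [h1]
  | insert b s hb ih =>
    intro m hm
    rw [Finset.prod_insert hb] at hm
    rw [Finset.sum_insert hb]
    exact yBound_mul (h b (Finset.mem_insert_self b s)) (ih fun i hi => h i (Finset.mem_insert_of_mem hi)) m hm

/-- Pole bound `0` of a finite product of pole-bound-`0` factors. [cite: Hartshorne1977, V.2 (ruled surfaces)] -/
theorem poleBound_finsetProd {ι : Type*} (s : Finset ι) (F : ι → MvPolynomial (Fin 2) ℂ)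
    (h : ∀ i ∈ s, ∀ m ∈ (F i).support, m 0 ≤ 0 + 2 * m 1) : ∀ m ∈ (∏ i ∈ s, F i).support, m 0 ≤ 0 + 2 * m 1 := by
  classical
  induction s using Finset.induction_on with
  | empty =>
    intro m hm
    rw [Finset.prod_empty, ← C_1] at hm
    exact poleBound_C 1 m hm
  | insert b s hb ih =>
    intro m hm
    rw [Finset.prod_insert hb] at hm
    have := poleBound_mul (h b (Finset.mem_insert_self b s)) (ih fun i hi => h i (Finset.mem_insert_of_mem hi)) m hm
    simpa using this

/-- `deg_y` bound of a finite sum. [cite: Hartshorne1977, V.2 (ruled surfaces)] -/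
theorem yBound_finsetSum {ι : Type*} (s : Finset ι) (F : ι → MvPolynomial (Fin 2) ℂ) (α : ℕ)
    (h : ∀ i ∈ s, ∀ m ∈ (F i).support, m 1 ≤ α) : ∀ m ∈ (∑ i ∈ s, F i).support, m 1 ≤ α := by
  classical
  induction s using Finset.induction_on with
  | empty => intro m hm; simp at hm
  | insert b s hb ih =>
    intro m hm
    rw [Finset.sum_insert hb] at hm
    exact yBound_add (h b (Finset.mem_insert_self b s)) (ih fun i hi => h i (Finset.mem_insert_of_mem hi)) m hm

/-- Pole bound of a finite sum. [cite: Hartshorne1977, V.2 (ruled surfaces)] -/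
theorem poleBound_finsetSum {ι : Type*} (s : Finset ι) (F : ι → MvPolynomial (Fin 2) ℂ) (N : ℕ)
    (h : ∀ i ∈ s, ∀ m ∈ (F i).support, m 0 ≤ N + 2 * m 1) : ∀ m ∈ (∑ i ∈ s, F i).support, m 0 ≤ N + 2 * m 1 := by
  classical
  induction s using Finset.induction_on with
  | empty => intro m hm; simp at hm
  | insert b s hb ih =>
    intro m hm
    rw [Finset.sum_insert hb] at hm
    exact poleBound_add (h b (Finset.mem_insert_self b s)) (ih fun i hi => h i (Finset.mem_insert_of_mem hi)) m hm

/-- **Substitution bound**: if every `f i` has `deg_y ≤ 1` and every monomial of `p ∈ ℂ[x₀, x₁, x₂]` has degree `≤ k`, then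
`deg_y (p(f₀, f₁, f₂)) ≤ k`. [cite: Hartshorne1977, V.2 (ruled surfaces)] -/
theorem yBound_aeval {f : Fin 3 → MvPolynomial (Fin 2) ℂ} (hf : ∀ i, ∀ m ∈ (f i).support, m 1 ≤ 1)
    (p : MvPolynomial (Fin 3) ℂ) (k : ℕ) (hp : ∀ δ ∈ p.support, δ.degree ≤ k) :
    ∀ m ∈ (aeval f p).support, m 1 ≤ k := by
  classical
  intro m hm
  rw [p.as_sum, map_sum] at hm
  refine yBound_finsetSum _ _ k (fun δ hδ => ?_) m hm
  rw [aeval_monomial, MvPolynomial.algebraMap_eq, Finsupp.prod]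
  intro m' hm'
  have h1 := yBound_mul (yBound_C (coeff δ p)) (yBound_finsetProd δ.support (fun i => f i ^ δ i) (fun i => δ i)
      (fun i _ => by simpa using yBound_pow (hf i) (δ i))) m' hm'
  have h2 : ∑ i ∈ δ.support, δ i = δ.degree := (Finsupp.degree_apply δ).symm
  have h3 := hp δ hδ
  omega

/-- **Substitution pole bound**: if every `f i` has pole bound `0`, so has `p(f₀, f₁, f₂)`. [cite: Hartshorne1977, V.2 (ruled surfaces)] -/
theorem poleBound_aeval {f : Fin 3 → MvPolynomial (Fin 2) ℂ} (hf : ∀ i, ∀ m ∈ (f i).support, m 0 ≤ 0 + 2 * m 1)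
    (p : MvPolynomial (Fin 3) ℂ) : ∀ m ∈ (aeval f p).support, m 0 ≤ 0 + 2 * m 1 := by
  classical
  intro m hm
  rw [p.as_sum, map_sum] at hm
  refine poleBound_finsetSum _ _ 0 (fun δ _ => ?_) m hm
  rw [aeval_monomial, MvPolynomial.algebraMap_eq, Finsupp.prod]
  intro m' hm'
  have h1 := poleBound_mul (poleBound_C (coeff δ p)) (poleBound_finsetProd δ.support (fun i => f i ^ δ i)
      (fun i _ => by simpa using poleBound_pow (hf i) (δ i))) m' hm'
  simpa using h1

/-- `deg_y u₀(s, y) ≤ 1`. [cite: Naie2007, §1.2 (normalization procedure) and Example 1] -/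
theorem yBound_planeU₀₂ : ∀ m ∈ (planeU₀₂ a d).support, m 1 ≤ 1 := by
  rw [planeU₀₂]
  refine yBound_mul (α₁ := 0) (α₂ := 1) (yBound_C d) (yBound_sub ?_ ?_)
  · exact yBound_mul (α₁ := 0) (α₂ := 1) (yBound_C _) (yBound_sub
      (yBound_mul (α₁ := 0) (α₂ := 1) (by simpa using yBound_pow yBound_X_zero 2) yBound_X_one)
      (yBound_mono (by norm_num) (yBound_C _)))
  · exact yBound_mul (α₁ := 0) (α₂ := 1) (yBound_C _) (yBound_sub yBound_X_one (yBound_mono (by norm_num) (yBound_C _)))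

/-- `deg_y u₁(s, y) ≤ 1`. [cite: Naie2007, §1.2 (normalization procedure) and Example 1] -/
theorem yBound_planeU₁₂ : ∀ m ∈ (planeU₁₂ a d).support, m 1 ≤ 1 := by
  rw [planeU₁₂]
  refine yBound_mul (α₁ := 0) (α₂ := 1) (yBound_C d) (yBound_sub ?_ ?_)
  · exact yBound_mul (α₁ := 0) (α₂ := 1) (yBound_C _) (yBound_sub yBound_X_one (yBound_mono (by norm_num) (yBound_C _)))
  · exact yBound_mul (α₁ := 0) (α₂ := 1) (yBound_C _) (yBound_sub
      (yBound_mul (α₁ := 0) (α₂ := 1) (by simpa using yBound_pow yBound_X_zero 2) yBound_X_one)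
      (yBound_mono (by norm_num) (yBound_C _)))

/-- `s²y` has pole bound `0`. [cite: Hartshorne1977, V.2 (ruled surfaces)] -/
private theorem poleBound_sqY : ∀ m ∈ (X 0 ^ 2 * X 1 : MvPolynomial (Fin 2) ℂ).support, m 0 ≤ 0 + 2 * m 1 := by
  have h : (X 0 ^ 2 * X 1 : MvPolynomial (Fin 2) ℂ) = monomial (Finsupp.single 0 2 + Finsupp.single 1 1) 1 := by
    rw [X_pow_eq_monomial, X, monomial_mul, mul_one]
  rw [h]
  exact poleBound_monomial _ 1 (by simp)

/-- Pole bound `0` for `u₀(s, y)`. [cite: Naie2007, §1.2 (normalization procedure) and Example 1] -/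
theorem poleBound_planeU₀₂ : ∀ m ∈ (planeU₀₂ a d).support, m 0 ≤ 0 + 2 * m 1 := by
  rw [planeU₀₂]
  refine poleBound_mono (N := 0 + 0) (M := 0) (by norm_num) (poleBound_mul (poleBound_C d) (poleBound_sub ?_ ?_))
  · exact poleBound_mono (N := 0 + 0) (M := 0) (by norm_num)
      (poleBound_mul (poleBound_C _) (poleBound_sub poleBound_sqY (poleBound_C _)))
  · exact poleBound_mono (N := 0 + 0) (M := 0) (by norm_num)
      (poleBound_mul (poleBound_C _) (poleBound_sub poleBound_X_one (poleBound_C _)))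

/-- Pole bound `0` for `u₁(s, y)`. [cite: Naie2007, §1.2 (normalization procedure) and Example 1] -/
theorem poleBound_planeU₁₂ : ∀ m ∈ (planeU₁₂ a d).support, m 0 ≤ 0 + 2 * m 1 := by
  rw [planeU₁₂]
  refine poleBound_mono (N := 0 + 0) (M := 0) (by norm_num) (poleBound_mul (poleBound_C d) (poleBound_sub ?_ ?_))
  · exact poleBound_mono (N := 0 + 0) (M := 0) (by norm_num)
      (poleBound_mul (poleBound_C _) (poleBound_sub poleBound_X_one (poleBound_C _)))
  · exact poleBound_mono (N := 0 + 0) (M := 0) (by norm_num)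
      (poleBound_mul (poleBound_C _) (poleBound_sub poleBound_sqY (poleBound_C _)))

/-- The monomials of `ψ₀ = Σ_δ a_δ x^δ` have degree `e − 1`. [cite: Kollar2007, §3.3] -/
theorem degree_le_of_mem_support_sum_monomial (c : DegIndex 1 (e - 1) → ℂ) :
    ∀ δ ∈ (∑ i : DegIndex 1 (e - 1), monomial i.1 (c i) : MvPolynomial (Fin 3) ℂ).support, δ.degree ≤ e - 1 := by
  classical
  intro δ hδ
  obtain ⟨i, -, hi⟩ := Finset.mem_biUnion.1 (support_sum hδ)
  have := support_monomial_subset hi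
  rw [Finset.mem_singleton] at this
  rw [this, i.2]

/-- The substitution data `(u₀, u₁, 1)` has `deg_y ≤ 1` componentwise, also after the swap `x₀ ↔ x₁`.
[cite: Naie2007, §1.2 (normalization procedure) and Example 1] -/
theorem yBound_planeSubstData (i : Fin 3) :
    (∀ m ∈ ((![planeU₀₂ a d, planeU₁₂ a d, 1] : Fin 3 → MvPolynomial (Fin 2) ℂ) i).support, m 1 ≤ 1) ∧
      ∀ m ∈ (((![planeU₀₂ a d, planeU₁₂ a d, 1] : Fin 3 → MvPolynomial (Fin 2) ℂ) ∘ Equiv.swap (0 : Fin 3) 1) i).support,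
        m 1 ≤ 1 := by
  have h1 : ∀ m ∈ (1 : MvPolynomial (Fin 2) ℂ).support, m 1 ≤ 1 := by
    rw [← C_1]; exact yBound_mono (by norm_num) (yBound_C 1)
  fin_cases i
  · exact ⟨yBound_planeU₀₂ a d, by simpa [Equiv.swap_apply_left] using yBound_planeU₁₂ a d⟩
  · exact ⟨yBound_planeU₁₂ a d, by simpa [Equiv.swap_apply_right] using yBound_planeU₀₂ a d⟩
  · exact ⟨h1, by simp [Equiv.swap_apply_of_ne_of_ne]⟩

/-- The substitution data `(u₀, u₁, 1)` has pole bound `0` componentwise, also after the swap.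
[cite: Naie2007, §1.2 (normalization procedure) and Example 1] -/
theorem poleBound_planeSubstData (i : Fin 3) :
    (∀ m ∈ ((![planeU₀₂ a d, planeU₁₂ a d, 1] : Fin 3 → MvPolynomial (Fin 2) ℂ) i).support, m 0 ≤ 0 + 2 * m 1) ∧
      ∀ m ∈ (((![planeU₀₂ a d, planeU₁₂ a d, 1] : Fin 3 → MvPolynomial (Fin 2) ℂ) ∘ Equiv.swap (0 : Fin 3) 1) i).support,
        m 0 ≤ 0 + 2 * m 1 := by
  have h1 : ∀ m ∈ (1 : MvPolynomial (Fin 2) ℂ).support, m 0 ≤ 0 + 2 * m 1 := by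
    rw [← C_1]; exact poleBound_C 1
  fin_cases i
  · exact ⟨poleBound_planeU₀₂ a d, by simpa [Equiv.swap_apply_left] using poleBound_planeU₁₂ a d⟩
  · exact ⟨poleBound_planeU₁₂ a d, by simpa [Equiv.swap_apply_right] using poleBound_planeU₀₂ a d⟩
  · exact ⟨h1, by simp [Equiv.swap_apply_of_ne_of_ne]⟩

/-- **`deg_y Ψ₂(a) ≤ e − 1` at every parameter.** [cite: Naie2007, §1.2 (normalization procedure) and Example 1] -/
theorem yBound_planeΨ₂ : ∀ m ∈ (planeΨ₂ a d).support, m 1 ≤ e - 1 := by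
  rw [planeΨ₂, ψOfR, map_add, aeval_rename]
  exact yBound_add
    (yBound_aeval (fun i => (yBound_planeSubstData a d i).1) _ _ (degree_le_of_mem_support_sum_monomial _))
    (yBound_aeval (fun i => (yBound_planeSubstData a d i).2) _ _ (degree_le_of_mem_support_sum_monomial _))

/-- **`Ψ₂(a)` has pole bound `0` at every parameter.** [cite: Naie2007, §1.2 (normalization procedure) and Example 1] -/
theorem poleBound_planeΨ₂ : ∀ m ∈ (planeΨ₂ a d).support, m 0 ≤ 0 + 2 * m 1 := by
  rw [planeΨ₂, ψOfR, map_add, aeval_rename]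
  exact poleBound_add (poleBound_aeval (fun i => (poleBound_planeSubstData a d i).1) _)
    (poleBound_aeval (fun i => (poleBound_planeSubstData a d i).2) _)

/-- **Support bounds of `G₂(a)`** (first clause of `IsChartExact e 1 G₂`), every parameter, `e ≥ 1`.
[cite: Hartshorne1977, V.2 (ruled surfaces)] -/
theorem bounds_planeG₂ (he : 1 ≤ e) : ∀ m ∈ (planeG₂ a d).support, m 1 ≤ e ∧ m 0 ≤ 1 + 2 * m 1 := by
  intro m hm
  rw [planeG₂_eq_C_mul_cubicY_mul, mul_assoc] at hm
  refine ⟨?_, ?_⟩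
  · have h := yBound_mul (yBound_C _) (yBound_mul yBound_cubicY (yBound_planeΨ₂ a d)) m hm
    omega
  · have h := poleBound_mul (poleBound_C _) (poleBound_mul poleBound_cubicY (poleBound_planeΨ₂ a d)) m hm
    omega

/-! ### Constant factors through the chart transforms -/

/-- `chartThree α (C κ · F) = C κ · chartThree α F`. [cite: Hartshorne1977, V.2 (ruled surfaces)] -/
theorem chartThree_C_mul (κ : ℂ) {α : ℕ} {F : MvPolynomial (Fin 2) ℂ} (hF : ∀ m ∈ F.support, m 1 ≤ α) :
    chartThree α (C κ * F) = C κ * chartThree α F := by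
  have h := chartThree_mul (α₁ := 0) (α₂ := α) (yBound_C κ) hF
  rw [zero_add] at h
  rw [h, chartThree_C, pow_zero, mul_one]

/-- `chartTwo N (C κ · F) = C κ · chartTwo N F`. [cite: Hartshorne1977, V.2 (ruled surfaces)] -/
theorem chartTwo_C_mul (κ : ℂ) {N : ℕ} {F : MvPolynomial (Fin 2) ℂ} (hF : ∀ m ∈ F.support, m 0 ≤ N + 2 * m 1) :
    chartTwo N (C κ * F) = C κ * chartTwo N F := by
  have h := chartTwo_mul (N₁ := 0) (N₂ := N) (poleBound_C κ) hF
  rw [zero_add] at h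
  rw [h, chartTwo_C, pow_zero, mul_one]

/-- `chartFour α N (C κ · F) = C κ · chartFour α N F`. [cite: Hartshorne1977, V.2 (ruled surfaces)] -/
theorem chartFour_C_mul (κ : ℂ) {α N : ℕ} {F : MvPolynomial (Fin 2) ℂ} (hF : ∀ m ∈ F.support, m 1 ≤ α ∧ m 0 ≤ N + 2 * m 1) :
    chartFour α N (C κ * F) = C κ * chartFour α N F := by
  have h := chartFour_mul (α₁ := 0) (α₂ := α) (N₁ := 0) (N₂ := N) (fun m hm => ⟨yBound_C κ m hm, poleBound_C κ m hm⟩) hF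
  rw [zero_add, zero_add] at h
  rw [h, chartFour_C, pow_zero, pow_zero, mul_one, mul_one]

/-! ### The three chart factorisations at every parameter -/

/-- **Chart `U₃`**: `chartThree e G₂(a) = κ · (s³ − s) · chartThree (e−1) Ψ₂(a)`, `e ≥ 1`. [cite: Hartshorne1977, V.2 (ruled surfaces)] -/
theorem chartThree_planeG₂ (he : 1 ≤ e) :
    chartThree e (planeG₂ a d) =
      C (d * (coefLin a 0 + coefLin a 1)) * (X 0 ^ 3 - X 0) * chartThree (e - 1) (planeΨ₂ a d) := by
  have hsplit : e = 1 + (e - 1) := by omega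
  have hb : ∀ m ∈ (X 0 * (X 0 - 1) * (X 0 + 1) * X 1 * planeΨ₂ a d : MvPolynomial (Fin 2) ℂ).support, m 1 ≤ e := by
    intro m hm; have := yBound_mul yBound_cubicY (yBound_planeΨ₂ a d) m hm; omega
  have h := chartThree_mul (α₁ := 1) (α₂ := e - 1) yBound_cubicY (yBound_planeΨ₂ a d)
  rw [← hsplit] at h
  rw [planeG₂_eq_C_mul_cubicY_mul, mul_assoc, chartThree_C_mul _ hb, h, chartThree_cubicY, mul_assoc]

/-- **Chart `U₂`**: `s′ · chartTwo 1 G₂(a) = −κ · (s′³ − s′)·y′ · chartTwo 0 Ψ₂(a)`. [cite: Hartshorne1977, V.2 (ruled surfaces)] -/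
theorem X_mul_chartTwo_planeG₂ :
    X 0 ^ (1 % 2) * chartTwo 1 (planeG₂ a d) =
      C (-(d * (coefLin a 0 + coefLin a 1))) * (X 0 * (X 0 - 1) * (X 0 + 1) * X 1) * chartTwo 0 (planeΨ₂ a d) := by
  have hb : ∀ m ∈ (X 0 * (X 0 - 1) * (X 0 + 1) * X 1 * planeΨ₂ a d : MvPolynomial (Fin 2) ℂ).support, m 0 ≤ 1 + 2 * m 1 := by
    intro m hm; have := poleBound_mul poleBound_cubicY (poleBound_planeΨ₂ a d) m hm; omega
  have h := chartTwo_mul (N₁ := 1) (N₂ := 0) poleBound_cubicY (poleBound_planeΨ₂ a d)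
  rw [Nat.add_zero] at h
  simp only [Nat.reduceMod, pow_one]
  rw [planeG₂_eq_C_mul_cubicY_mul, mul_assoc, chartTwo_C_mul _ hb, h, chartTwo_cubicY]
  simp only [map_neg, map_mul]
  ring

/-- **Chart `U₄`**: `s′ · chartFour e 1 G₂(a) = −κ · (s′³ − s′) · chartFour (e−1) 0 Ψ₂(a)`, `e ≥ 1`.
[cite: Hartshorne1977, V.2 (ruled surfaces)] -/
theorem X_mul_chartFour_planeG₂ (he : 1 ≤ e) :
    X 0 ^ (1 % 2) * chartFour e 1 (planeG₂ a d) =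
      C (-(d * (coefLin a 0 + coefLin a 1))) * (X 0 * (X 0 - 1) * (X 0 + 1)) * chartFour (e - 1) 0 (planeΨ₂ a d) := by
  have hsplit : e = 1 + (e - 1) := by omega
  have hbc : ∀ m ∈ (X 0 * (X 0 - 1) * (X 0 + 1) * X 1 : MvPolynomial (Fin 2) ℂ).support, m 1 ≤ 1 ∧ m 0 ≤ 1 + 2 * m 1 :=
    fun m hm => ⟨yBound_cubicY m hm, poleBound_cubicY m hm⟩
  have hbΨ : ∀ m ∈ (planeΨ₂ a d).support, m 1 ≤ e - 1 ∧ m 0 ≤ 0 + 2 * m 1 :=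
    fun m hm => ⟨yBound_planeΨ₂ a d m hm, poleBound_planeΨ₂ a d m hm⟩
  have hb : ∀ m ∈ (X 0 * (X 0 - 1) * (X 0 + 1) * X 1 * planeΨ₂ a d : MvPolynomial (Fin 2) ℂ).support,
      m 1 ≤ e ∧ m 0 ≤ 1 + 2 * m 1 := by
    intro m hm
    have h1 := yBound_mul yBound_cubicY (yBound_planeΨ₂ a d) m hm
    have h2 := poleBound_mul poleBound_cubicY (poleBound_planeΨ₂ a d) m hm
    omega
  have h := chartFour_mul (α₁ := 1) (α₂ := e - 1) (N₁ := 1) (N₂ := 0) hbc hbΨ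
  rw [← hsplit, Nat.add_zero] at h
  simp only [Nat.reduceMod, pow_one]
  rw [planeG₂_eq_C_mul_cubicY_mul, mul_assoc, chartFour_C_mul _ hb, h, chartFour_cubicY]
  simp only [map_neg, map_mul]
  ring

end Literature.AlgebraicGeometry.HodgeTheory.Q8Family

end
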